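import Literature.NumberTheory.EllipticCurves.SUnitMordellCurveConstructions
import Literature.NumberTheory.EllipticCurves.HeightConductorBoundsModularityProofs
import Literature.NumberTheory.EllipticCurves.IsogenyConductorProofs
import Mathlib.Analysis.Complex.ExponentialBounds
import HarnessLib

/-!
# von Känel–Matschke, Prop. 10.6 (refined `abc` height bound) from Lemma 10.5 and (eq:szpiro) —
# the printed proof of §10.4, in kernel

Topic `Literature/NumberTheory/DiophantineGeometry` (family `abc`, LADDER-ABC A1: the *modular method*).
Theorems only — NO new statement (D-0026). von Känel–Matschke, arXiv:1605.06079 = Mem. AMS **286**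
(2023) no. 1419 [`VonkanelMatschke2023`], §10.4 (arXiv numbering), proof of Prop. 10.6 (`prop:abc`):
"the elliptic curves appearing in Lemma 10.5 have the same conductor since they are `ℚ`-isogenous …
`|ab|c⁴ ≤ 2²⁸ Δ_{E'}` … `N_{E'} ∣ 2^𝔢 N_S` … `|c| − 1 ≤ |ab|` … `(|c|−1)⁵ ≤ 2²⁸ Δ_{E'}` …
`ν(N_{E'}) ≤ λ N_S` … (eq:szpiro) leads to Proposition 10.6 provided that `H = |c|` … `(b,−c,−a)` and
`(a,−c,−b)` are solutions of (eq:abc) as well."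

* `abc_log_max_le_refined_of_lemma_10_5` — **the named fact `abc_log_max_le_refined` (Prop. 10.6) follows
  from `vonKanelMatschke_lemma_10_5` and `vonKanelMatschke_log_minimalDiscriminant_le` ((eq:szpiro))**,
  granted two inputs the printed proof uses silently, taken from the tree by name: isogeny invariance of
  the conductor (Ogg–Saito schema `artinConductorExponent_tate_eq_conductorExponent_of_isElliptic`, via
  `conductorNorm_eq_of_isIsogenous_of_tate`) and `N_E ≥ 11` (modularity, `eleven_le_conductorNorm_of_modularity`;
  needed where the printed comparison of triple logarithms is used: for `2^𝔢 N_S ≤ 15` the kernel shows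
  `N_{E'} = 2^𝔢 N_S` and `ν(N_{E'}) = λ N_S` exactly). Bookkeeping: `N_S` is even (parity); with
  `N_{E'} = 2^k N_odd` (`k = 𝔢 + 1`) and `N_S/2 = t · N_odd`: `2^𝔢 N_S = t · N_{E'}`, `t · ν(N_{E'}) = λ N_S`
  (`ν(N_{E'}) = (3/4)^{[4 ∣ N]} N_{E'}`, no odd square divides `N_{E'} ∣ 2⁴ N_S`); constant
  `(33 log 2 + 115.1)/5 = 27.59… ≤ 28`.
* `abc_log_max_le_refined_of_lemma_10_5_of_conductorNorm_eq` — the same, conductor invariance as a hypothesis.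
* `abc_log_max_le_refined_of_modularity_of_prop_10_8` — with `log_minimalDiscriminant_le_of_prop_10_8`:
  Prop. 10.6 from {modularity, Ogg–Saito schema, Lemma 10.5, Prop. 10.8 (i), (ii)}; the printed DAG
  `Lemma 10.5 + Prop. 10.8 ⟹ (eq:szpiro) ⟹ Prop. 10.6 ⟹ Prop. 10.2 (2nd display)` of §10.4–§10.5 holds in
  kernel up to its roots (`sUnitEquation_height_le_two_of_abc_log_max_le_refined`).

No `abc` claim; typed ≠ proved: the roots remain named facts. References: [VonkanelMatschke2023] §10.4
(Lemma 10.5, (eq:refinedcondbound), Prop. 10.6), §10.5 ((eq:szpiro)); [SilvermanATAEC1994] Ex. 4.40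
with §IV.10 (isogeny invariance of the conductor).
-/

noncomputable section

open Height WeierstrassCurve
open Literature.NumberTheory.EllipticCurves
open Literature.NumberTheory.EllipticCurves.ModularForms

namespace Literature.NumberTheory.DiophantineGeometry

namespace VonKanelMatschke

/-! ### Real-analysis helpers for the (junk-valued) triple logarithm -/

/-- `log log log x ≥ 0` for `x ≥ 16` (`log 16 = 4 log 2 > e`). [folklore] -/
private theorem logloglog_nonneg_of_le16 {x : ℝ} (hx : 16 ≤ x) :
    0 ≤ Real.log (Real.log (Real.log x)) := by
  have hl2 := Real.log_two_gt_d9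
  have he := Real.exp_one_lt_d9
  have h16 : Real.log 16 = 4 * Real.log 2 := by
    rw [show (16 : ℝ) = 2 ^ 4 by norm_num, Real.log_pow]; push_cast; ring
  have h1 : Real.exp 1 ≤ Real.log x := by
    have := Real.log_le_log (by norm_num) hx
    linarith
  have h2 : 1 ≤ Real.log (Real.log x) := by
    have := Real.log_le_log (Real.exp_pos 1) h1
    rwa [Real.log_exp] at this
  exact Real.log_nonneg h2

/-- Monotonicity of the triple logarithm where it is positive: for `2 ≤ y ≤ z` with `log₃ y > 0`,
`log₃ y ≤ log₃ z`. [folklore] -/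
private theorem logloglog_mono {y z : ℝ} (hy : 2 ≤ y) (hyz : y ≤ z)
    (hpos : 0 < Real.log (Real.log (Real.log y))) :
    Real.log (Real.log (Real.log y)) ≤ Real.log (Real.log (Real.log z)) := by
  have hl2 := Real.log_two_gt_d9
  have he := Real.exp_one_gt_d9
  have hL1 : Real.log 2 ≤ Real.log y := Real.log_le_log (by norm_num) hy
  have hL1pos : 0 < Real.log y := by linarith
  have hm1 : -1 ≤ Real.log (Real.log y) := by
    have h1 : Real.exp (-1) ≤ Real.log 2 := by
      rw [Real.exp_neg]
      have : (Real.exp 1)⁻¹ ≤ (2.7182818283 : ℝ)⁻¹ := inv_anti₀ (by norm_num) he.le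
      have h2 : (2.7182818283 : ℝ)⁻¹ ≤ 0.6931471803 := by norm_num
      linarith
    have h2 : Real.log (Real.exp (-1)) ≤ Real.log (Real.log y) :=
      Real.log_le_log (Real.exp_pos _) (h1.trans hL1)
    rwa [Real.log_exp] at h2
  have hL2pos : 0 < Real.log (Real.log y) := by
    by_contra h
    push Not at h
    rcases eq_or_lt_of_le h with h0 | hlt
    · rw [h0, Real.log_zero] at hpos; exact lt_irrefl _ hpos
    · have : Real.log (Real.log (Real.log y)) ≤ 0 := by
        rw [← Real.log_neg_eq_log]
        exact Real.log_nonpos (by linarith) (by linarith)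
      linarith
  have h1 : Real.log y ≤ Real.log z := Real.log_le_log (by linarith) hyz
  have h2 : Real.log (Real.log y) ≤ Real.log (Real.log z) := Real.log_le_log hL1pos h1
  exact Real.log_le_log hL2pos h2

/-! ### Arithmetic helpers: `N_S` has no square prime factor; `ν(N)` for `N ∣ 2⁴ N_S` -/

/-- No prime square divides `N_S = ∏_{p ∈ S} p` (`S` a set of primes). [cite: VonkanelMatschke2023, §1 (N_S)] -/
private theorem sq_not_dvd_primesProd {S : Finset ℕ} (hS : ∀ p ∈ S, p.Prime) {p : ℕ} (hp : p.Prime) :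
    ¬ p ^ 2 ∣ primesProd S := by
  intro h
  unfold primesProd at h
  have hp' := hp.prime
  have h1 : p ∣ ∏ q ∈ S, q := (dvd_pow_self p two_ne_zero).trans h
  obtain ⟨q, hqS, hpq⟩ := (hp'.dvd_finsetProd_iff (fun q => q)).mp h1
  have hpq' : p = q := (Nat.prime_dvd_prime_iff_eq hp (hS q hqS)).mp hpq
  subst hpq'
  rw [← Finset.mul_prod_erase S (fun q => q) hqS, pow_two] at h
  have h2 : p ∣ ∏ q ∈ S.erase p, q := (mul_dvd_mul_iff_left hp.ne_zero).mp h
  obtain ⟨q', hq'S, hpq''⟩ := (hp'.dvd_finsetProd_iff (fun q => q)).mp h2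
  have heq : p = q' := (Nat.prime_dvd_prime_iff_eq hp (hS q' (Finset.mem_of_mem_erase hq'S))).mp hpq''
  subst heq
  exact (Finset.mem_erase.mp hq'S).1 rfl

/-- **`ν(N)` for `N` with no odd square factor**: `ν(N) = (3/4) N` if `4 ∣ N` and `ν(N) = N` otherwise
(the product `∏_{p² ∣ N}(1 − p⁻²)` has at most the factor `p = 2`). [cite: VonkanelMatschke2023, Prop. 10.8 (ii) (definition of ν)] -/
private theorem condNu_eq_of_odd_sq_free {N : ℕ} (hN0 : N ≠ 0)
    (hodd : ∀ p : ℕ, p.Prime → p ≠ 2 → ¬ p ^ 2 ∣ N) :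
    condNu N = if 4 ∣ N then 3 / 4 * (N : ℝ) else (N : ℝ) := by
  unfold condNu
  by_cases h4 : 4 ∣ N
  · have hs : N.primeFactors.filter (fun p => p ^ 2 ∣ N) = {2} := by
      refine Finset.eq_singleton_iff_unique_mem.mpr ⟨?_, ?_⟩
      · exact Finset.mem_filter.mpr
          ⟨Nat.mem_primeFactors.mpr ⟨Nat.prime_two, dvd_trans (by norm_num) h4, hN0⟩, by simpa using h4⟩
      · intro p hp
        obtain ⟨hp1, hp2⟩ := Finset.mem_filter.mp hp
        by_contra hne
        exact hodd p (Nat.prime_of_mem_primeFactors hp1) hne hp2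
    rw [hs, if_pos h4, Finset.prod_singleton]
    push_cast
    ring
  · have hs : N.primeFactors.filter (fun p => p ^ 2 ∣ N) = ∅ := by
      refine Finset.filter_eq_empty_iff.mpr ?_
      intro p hp hp2
      by_cases hne : p = 2
      · subst hne; exact h4 (by simpa using hp2)
      · exact hodd p (Nat.prime_of_mem_primeFactors hp) hne hp2
    rw [hs, if_neg h4, Finset.prod_empty, mul_one]

/-! ### The analytic tail of the printed proof -/

/-- The real-number tail of the proof of Prop. 10.6: with `Y = 2^𝔢 N_S = t · N` (`t ≥ 1`), `t · ν = λ N_S`,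
(eq:szpiro) for `E'` at conductor `N ≥ 11`, and `(|c| − 1)⁵ ≤ 2²⁸ Δ_{E'}`, `|c| ≥ 2`, one gets
`log|c| ≤ (λ/5) N_S log Y + (3λ/40) N_S log₃ Y + (2λ/15) N_S + 28`.
[cite: VonkanelMatschke2023, §10.4 (proof of Prop. 10.6)] -/
private theorem core_tail {N t : ℕ} {ν lam P Y D C : ℝ} (hN11 : 11 ≤ N) (ht1 : 1 ≤ t)
    (hY : Y = (N : ℝ) * t) (hν0 : 0 ≤ ν) (hνt : ν * t = lam * P)
    (hD : Real.log D ≤ ν * Real.log (N : ℝ) +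
      3 / 8 * ν * Real.log (Real.log (Real.log (N : ℝ))) + 2 / 3 * ν + 115.1)
    (hC2 : 2 ≤ C) (hCD : (C - 1) ^ 5 ≤ 2 ^ 28 * D) (hD0 : 0 < D) :
    Real.log C ≤ lam / 5 * P * Real.log Y + 3 * lam / 40 * P * Real.log (Real.log (Real.log Y)) +
      2 * lam / 15 * P + 28 := by
  have hl2 := Real.log_two_lt_d9
  have hN' : (11 : ℝ) ≤ N := by exact_mod_cast hN11
  have ht' : (1 : ℝ) ≤ t := by exact_mod_cast ht1
  have hN0 : (0 : ℝ) < N := by linarith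
  have hNY : (N : ℝ) ≤ Y := by rw [hY]; nlinarith
  have hlogN0 : 0 ≤ Real.log (N : ℝ) := Real.log_nonneg (by linarith)
  have hlogNY : Real.log (N : ℝ) ≤ Real.log Y := Real.log_le_log hN0 hNY
  have hlamP : ν ≤ lam * P := by rw [← hνt]; nlinarith
  have h1 : ν * Real.log (N : ℝ) ≤ lam * P * Real.log Y := by
    calc ν * Real.log (N : ℝ) ≤ ν * Real.log Y := mul_le_mul_of_nonneg_left hlogNY hν0
      _ ≤ lam * P * Real.log Y := mul_le_mul_of_nonneg_right hlamP (by linarith)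
  have h2 : ν * Real.log (Real.log (Real.log (N : ℝ))) ≤
      lam * P * Real.log (Real.log (Real.log Y)) := by
    by_cases hy : 0 ≤ Real.log (Real.log (Real.log Y))
    · by_cases hn : 0 < Real.log (Real.log (Real.log (N : ℝ)))
      · have hmono := logloglog_mono (by linarith) hNY hn
        calc ν * Real.log (Real.log (Real.log (N : ℝ)))
            ≤ ν * Real.log (Real.log (Real.log Y)) := mul_le_mul_of_nonneg_left hmono hν0
          _ ≤ lam * P * Real.log (Real.log (Real.log Y)) := mul_le_mul_of_nonneg_right hlamP hy
      · push Not at hn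
        have h3 : ν * Real.log (Real.log (Real.log (N : ℝ))) ≤ 0 :=
          mul_nonpos_of_nonneg_of_nonpos hν0 hn
        have h4 : 0 ≤ lam * P * Real.log (Real.log (Real.log Y)) := mul_nonneg (hν0.trans hlamP) hy
        linarith
    · -- `Y < 16`, hence `t = 1`: `Y = N` and `ν = λ N_S`
      push Not at hy
      have hY16 : Y < 16 := lt_of_not_ge fun h16 => absurd (logloglog_nonneg_of_le16 h16) (not_le.mpr hy)
      have ht2 : t < 2 := by
        by_contra h
        have : (2 : ℝ) ≤ t := by exact_mod_cast (not_lt.mp h)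
        nlinarith
      have ht_eq : t = 1 := by omega
      subst ht_eq
      have hYN : Y = N := by rw [hY]; simp
      have hνeq : ν = lam * P := by rw [← hνt]; simp
      rw [hYN, hνeq]
  have hC1 : 0 < C - 1 := by linarith
  have h3 : 5 * Real.log (C - 1) ≤ 28 * Real.log 2 + Real.log D := by
    have := Real.log_le_log (by positivity) hCD
    rw [Real.log_pow, Real.log_mul (by norm_num) hD0.ne', Real.log_pow] at this
    push_cast at this; linarith
  have h4 : Real.log C ≤ Real.log 2 + Real.log (C - 1) := by
    rw [← Real.log_mul (by norm_num) hC1.ne']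
    exact Real.log_le_log (by linarith) (by linarith)
  have h5 : 2 / 3 * ν ≤ 2 / 3 * (lam * P) := by linarith
  linarith

/-! ### Prop. 10.6 for the largest coordinate (`H = |c|`) -/

/-- The case `H = |c|` of the printed proof of Prop. 10.6 (`|a|, |b| ≤ |c|`): for a solution of
(eq:abc), `log|c| ≤ (λ/5) N_S log(2^𝔢 N_S) + (3λ/40) N_S log₃(2^𝔢 N_S) + (2λ/15) N_S + 28`.
[cite: VonkanelMatschke2023, §10.4 (proof of Prop. 10.6, case H = |c|)] -/
private theorem core (hmod : nonempty_modularParametrizationData)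
    (hcond : ∀ (W W' : WeierstrassCurve ℚ) [W.IsElliptic] [W'.IsElliptic], W.IsIsogenous W' → W.conductorNorm ℤ = W'.conductorNorm ℤ)
    (h105 : vonKanelMatschke_lemma_10_5) (hsz : vonKanelMatschke_log_minimalDiscriminant_le)
    {S : Finset ℕ} (hS : ∀ p ∈ S, p.Prime) {a b c : ℤ} (ha : a ≠ 0) (hb : b ≠ 0) (hc : c ≠ 0)
    (habc : a + b = c) (hg : Int.gcd (Int.gcd a b : ℤ) c = 1)
    (hrad : UniqueFactorizationMonoid.radical (a * b * c).natAbs ∣ primesProd S)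
    (hac : |a| ≤ |c|) (hbc : |b| ≤ |c|) :
    Real.log |(c : ℝ)| ≤
      refinedCoeff (padicValNat 2 (a * b * c).natAbs) / 5 * (primesProd S : ℝ) *
          Real.log ((2 : ℝ) ^ refinedExp (padicValNat 2 (a * b * c).natAbs) * primesProd S) +
        3 * refinedCoeff (padicValNat 2 (a * b * c).natAbs) / 40 * (primesProd S : ℝ) *
          Real.log (Real.log (Real.log
            ((2 : ℝ) ^ refinedExp (padicValNat 2 (a * b * c).natAbs) * primesProd S))) +
        2 * refinedCoeff (padicValNat 2 (a * b * c).natAbs) / 15 * (primesProd S : ℝ) + 28 := by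
  have hc2 : 2 ≤ |c| := by
    by_contra hlt
    have hc1 : |c| ≤ 1 := by push Not at hlt; omega
    obtain ⟨hc1a, hc1b⟩ := abs_le.mp hc1
    obtain ⟨ha1, ha2⟩ := abs_le.mp (hac.trans hc1)
    obtain ⟨hb1, hb2⟩ := abs_le.mp (hbc.trans hc1)
    omega
  have hab : |c| - 1 ≤ |a| * |b| := by
    have h1 : |c| ≤ |a| + |b| := by rw [← habc]; exact abs_add_le a b
    nlinarith [Int.one_le_abs ha, Int.one_le_abs hb]
  obtain ⟨W, W', hW, hW', hiso, hNdvd, hv, -, m, hm3, hΔ'⟩ := h105 S hS a b c ha hb hc habc hg hrad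
  haveI := hW
  haveI := hW'
  set N : ℕ := W.conductorNorm ℤ with hNdef
  have hN11 : 11 ≤ N := eleven_le_conductorNorm_of_modularity hmod W
  have hN0 : N ≠ 0 := by omega
  have hN'eq : W'.conductorNorm ℤ = N := (hcond W W' hiso).symm
  have hΔ'pos : 0 < W'.minimalDiscriminantNorm ℤ := minimalDiscriminantNorm_pos_holds _
  have hszW := hsz W'
  rw [hN'eq] at hszW
  set P : ℕ := primesProd S with hPdef
  have hP1 : 1 ≤ P := one_le_primesProd hS
  have habc0 : (a * b * c).natAbs ≠ 0 := Int.natAbs_ne_zero.mpr (mul_ne_zero (mul_ne_zero ha hb) hc)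
  have h2dvd : (2 : ℤ) ∣ a * b * c := by
    rcases Int.even_or_odd a with hA | hA
    · exact ((even_iff_two_dvd.mp hA).mul_right b).mul_right c
    · rcases Int.even_or_odd b with hB | hB
      · exact ((even_iff_two_dvd.mp hB).mul_left a).mul_right c
      · have hCe : Even c := by rw [← habc]; exact hA.add_odd hB
        exact (even_iff_two_dvd.mp hCe).mul_left (a * b)
  have h2P : 2 ∣ P := by
    have h2n : 2 ∣ (a * b * c).natAbs := Int.natAbs_dvd_natAbs.mpr h2dvd
    have h2r : 2 ∣ UniqueFactorizationMonoid.radical (a * b * c).natAbs := by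
      rw [Nat.radical_eq_prod_primeFactors]
      exact Finset.dvd_prod_of_mem (fun p : ℕ => p)
        (Nat.mem_primeFactors.mpr ⟨Nat.prime_two, h2n, habc0⟩)
    exact h2r.trans hrad
  obtain ⟨y₂, hy₂⟩ := h2P
  have hy₂0 : y₂ ≠ 0 := by rintro rfl; omega
  set k : ℕ := padicValNat 2 N with hkdef
  obtain ⟨Nodd, hNodd⟩ : 2 ^ k ∣ N := pow_padicValNat_dvd
  have hNodd2 : ¬ 2 ∣ Nodd := by
    rintro ⟨u, hu⟩
    have : 2 ^ (k + 1) ∣ N := ⟨u, by rw [hNodd, hu]; ring⟩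
    exact pow_succ_padicValNat_not_dvd (p := 2) hN0 this
  have hNoddP : Nodd ∣ y₂ := by
    have h1 : Nodd ∣ 2 ^ 4 * P := (Dvd.intro_left _ hNodd.symm).trans hNdvd
    rw [hy₂, show 2 ^ 4 * (2 * y₂) = y₂ * 2 ^ 5 by ring] at h1
    have hcop : Nat.Coprime Nodd (2 ^ 5) :=
      Nat.Coprime.pow_right 5 ((Nat.Prime.coprime_iff_not_dvd Nat.prime_two).mpr hNodd2).symm
    exact hcop.dvd_of_dvd_mul_right h1
  obtain ⟨t, ht⟩ := hNoddP
  have ht1 : 1 ≤ t := Nat.pos_of_ne_zero (by rintro rfl; rw [mul_zero] at ht; exact hy₂0 ht)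
  have hsqf : ∀ p : ℕ, p.Prime → p ≠ 2 → ¬ p ^ 2 ∣ N := by
    intro p hp hp2 hpN
    have h1 : p ^ 2 ∣ P * 2 ^ 4 := by rw [mul_comm]; exact hpN.trans hNdvd
    have hcop : Nat.Coprime (p ^ 2) (2 ^ 4) :=
      Nat.Coprime.pow _ _ ((Nat.coprime_primes hp Nat.prime_two).mpr hp2)
    exact sq_not_dvd_primesProd hS hp (hcop.dvd_of_dvd_mul_right h1)
  have hνeq := condNu_eq_of_odd_sq_free hN0 hsqf
  have hν0 : 0 ≤ condNu N := condNu_nonneg N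
  have hPr : (P : ℝ) = 2 * (Nodd : ℝ) * t := by rw [hy₂, ht]; push_cast; ring
  have hD0 : (0 : ℝ) < (W'.minimalDiscriminantNorm ℤ : ℝ) := by exact_mod_cast hΔ'pos
  have hc2r : (2 : ℝ) ≤ |(c : ℝ)| := by exact_mod_cast hc2
  have habr : |(c : ℝ)| - 1 ≤ |(a : ℝ)| * |(b : ℝ)| := by exact_mod_cast hab
  have hΔr : (2 : ℝ) ^ (12 * m) * (W'.minimalDiscriminantNorm ℤ : ℝ) =
      2 ^ 8 * (|(a : ℝ)| * |(b : ℝ)|) * |(c : ℝ)| ^ 4 := by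
    have h' : ((2 ^ (12 * m) * W'.minimalDiscriminantNorm ℤ : ℕ) : ℝ) =
        ((2 ^ 8 * (a * b).natAbs * c.natAbs ^ 4 : ℕ) : ℝ) := by exact_mod_cast hΔ'
    push_cast [Int.natAbs_mul, Nat.cast_natAbs, Int.cast_abs] at h'
    linarith
  have hm : (2 : ℝ) ^ (12 * m) ≤ 2 ^ 36 := pow_le_pow_right₀ (by norm_num) (by omega)
  have hCD : (|(c : ℝ)| - 1) ^ 5 ≤ 2 ^ 28 * (W'.minimalDiscriminantNorm ℤ : ℝ) := by
    have h0 : 0 ≤ |(c : ℝ)| - 1 := by linarith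
    have h1 : (|(c : ℝ)| - 1) ^ 4 ≤ |(c : ℝ)| ^ 4 := pow_le_pow_left₀ h0 (by linarith) 4
    have h2 : (|(c : ℝ)| - 1) ^ 5 ≤ (|(a : ℝ)| * |(b : ℝ)|) * |(c : ℝ)| ^ 4 := by
      rw [pow_succ']
      exact mul_le_mul habr h1 (by positivity) (by positivity)
    have h3 : (|(a : ℝ)| * |(b : ℝ)|) * |(c : ℝ)| ^ 4 ≤ 2 ^ 28 * (W'.minimalDiscriminantNorm ℤ : ℝ) := by
      nlinarith
    linarith
  set v : ℕ := padicValNat 2 (a * b * c).natAbs with hvdef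
  have he : (refinedExp v = 4 ∧ refinedCoeff v = 12) ∨ (refinedExp v = 2 ∧ refinedCoeff v = 3) ∨
      (refinedExp v = -1 ∧ refinedCoeff v = 1 / 2) ∨ (refinedExp v = 0 ∧ refinedCoeff v = 1) := by
    unfold refinedExp refinedCoeff
    split_ifs <;> norm_num
  rcases he with ⟨he', hl'⟩ | ⟨he', hl'⟩ | ⟨he', hl'⟩ | ⟨he', hl'⟩ <;> rw [he', hl'] <;> rw [he'] at hv
  · -- `(𝔢, λ) = (4, 12)`: `k = 5`, `N = 32 N_odd`, `ν = (3/4) N`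
    have hk : k = 5 := by omega
    have hNr : (N : ℝ) = 32 * (Nodd : ℝ) := by rw [hNodd, hk]; push_cast; ring
    have hν : condNu N = 3 / 4 * (N : ℝ) := by rw [hνeq, if_pos ⟨8 * Nodd, by rw [hNodd, hk]; ring⟩]
    exact core_tail hN11 ht1 (by rw [hPr, hNr]; norm_num; ring) hν0 (by rw [hν, hNr, hPr]; ring)
      hszW hc2r hCD hD0
  · -- `(𝔢, λ) = (2, 3)`: `k = 3`, `N = 8 N_odd`, `ν = (3/4) N`
    have hk : k = 3 := by omega
    have hNr : (N : ℝ) = 8 * (Nodd : ℝ) := by rw [hNodd, hk]; push_cast; ring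
    have hν : condNu N = 3 / 4 * (N : ℝ) := by rw [hνeq, if_pos ⟨2 * Nodd, by rw [hNodd, hk]; ring⟩]
    exact core_tail hN11 ht1 (by rw [hPr, hNr]; norm_num; ring) hν0 (by rw [hν, hNr, hPr]; ring)
      hszW hc2r hCD hD0
  · -- `(𝔢, λ) = (−1, 1/2)`: `k = 0`, `N = N_odd`, `ν = N`
    have hk : k = 0 := by omega
    have hNr : (N : ℝ) = (Nodd : ℝ) := by rw [hNodd, hk]; push_cast; ring
    have h4N : ¬ 4 ∣ N := fun ⟨u, hu⟩ => hNodd2 ⟨2 * u, by rw [hNodd, hk] at hu; omega⟩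
    have hν : condNu N = (N : ℝ) := by rw [hνeq, if_neg h4N]
    exact core_tail hN11 ht1 (by rw [zpow_neg_one, hPr, hNr]; ring) hν0 (by rw [hν, hNr, hPr]; ring)
      hszW hc2r hCD hD0
  · -- `(𝔢, λ) = (0, 1)`: `k = 1`, `N = 2 N_odd`, `ν = N`
    have hk : k = 1 := by omega
    have hNr : (N : ℝ) = 2 * (Nodd : ℝ) := by rw [hNodd, hk]; push_cast; ring
    have h4N : ¬ 4 ∣ N := fun ⟨u, hu⟩ => hNodd2 ⟨u, by rw [hNodd, hk] at hu; omega⟩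
    have hν : condNu N = (N : ℝ) := by rw [hνeq, if_neg h4N]
    exact core_tail hN11 ht1 (by rw [zpow_zero, hPr, hNr]; ring) hν0 (by rw [hν, hNr, hPr]; ring)
      hszW hc2r hCD hD0

/-! ### Prop. 10.6 -/

/-- **vKM Prop. 10.6 ⟸ Lemma 10.5 + (eq:szpiro)** (PROVED deduction of §10.4, granted modularity for
`N_E ≥ 11` and isogeny invariance of the conductor `hcond`); the cases `H = |a|`, `H = |b|` are reduced to
`H = |c|` by the solutions `(b, −c, −a)`, `(a, −c, −b)`. [cite: VonkanelMatschke2023, Prop. 10.6 (arXiv §10.4, prop:abc) and its proof] -/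
theorem abc_log_max_le_refined_of_lemma_10_5_of_conductorNorm_eq (hmod : nonempty_modularParametrizationData)
    (hcond : ∀ (W W' : WeierstrassCurve ℚ) [W.IsElliptic] [W'.IsElliptic], W.IsIsogenous W' → W.conductorNorm ℤ = W'.conductorNorm ℤ)
    (h105 : vonKanelMatschke_lemma_10_5) (hsz : vonKanelMatschke_log_minimalDiscriminant_le) :
    abc_log_max_le_refined := by
  intro S hS a b c ha hb hc habc hg hrad
  have hg' : ∀ x y z : ℤ, Int.gcd (Int.gcd x y : ℤ) z = 1 → Int.gcd (Int.gcd y (-z) : ℤ) (-x) = 1 := by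
    intro x y z h; simp only [Int.gcd, Int.natAbs_neg, Int.natAbs_natCast] at h ⊢
    rwa [Nat.gcd_comm, ← Nat.gcd_assoc]
  have hg'' : ∀ x y z : ℤ, Int.gcd (Int.gcd x y : ℤ) z = 1 → Int.gcd (Int.gcd x (-z) : ℤ) (-y) = 1 := by
    intro x y z h; simp only [Int.gcd, Int.natAbs_neg, Int.natAbs_natCast] at h ⊢
    rwa [Nat.gcd_assoc, Nat.gcd_comm z.natAbs, ← Nat.gcd_assoc]
  push_cast
  have cast_le : ∀ {x y : ℤ}, |x| ≤ |y| → |(x : ℝ)| ≤ |(y : ℝ)| := fun h => by exact_mod_cast h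
  have eB : a * -c * -b = a * b * c := by ring
  have eA : b * -c * -a = a * b * c := by ring
  rcases le_total |a| |c| with hac | hca
  · rcases le_total |b| |c| with hbc | hcb
    · rw [max_eq_right (cast_le hbc), max_eq_right (cast_le hac)]
      exact core hmod hcond h105 hsz hS ha hb hc habc hg hrad hac hbc
    · rw [max_eq_left (cast_le hcb), max_eq_right (cast_le (hac.trans hcb))]
      have key := core hmod hcond h105 hsz hS ha (neg_ne_zero.mpr hc) (neg_ne_zero.mpr hb) (by linarith)
        (hg'' a b c hg) (by rw [eB]; exact hrad) (by rw [abs_neg]; exact hac.trans hcb)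
        (by rw [abs_neg, abs_neg]; exact hcb)
      rw [eB] at key; push_cast [abs_neg] at key; exact key
  · rcases le_total |b| |a| with hba | hab
    · rw [max_eq_left (max_le (cast_le hba) (cast_le hca))]
      have key := core hmod hcond h105 hsz hS hb (neg_ne_zero.mpr hc) (neg_ne_zero.mpr ha) (by linarith)
        (hg' a b c hg) (by rw [eA]; exact hrad) (by rw [abs_neg]; exact hba)
        (by rw [abs_neg, abs_neg]; exact hca)
      rw [eA] at key; push_cast [abs_neg] at key; exact key
    · rw [max_eq_left (cast_le (hca.trans hab)), max_eq_right (cast_le hab)]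
      have key := core hmod hcond h105 hsz hS ha (neg_ne_zero.mpr hc) (neg_ne_zero.mpr hb) (by linarith)
        (hg'' a b c hg) (by rw [eB]; exact hrad) (by rw [abs_neg]; exact hab)
        (by rw [abs_neg, abs_neg]; exact hca.trans hab)
      rw [eB] at key; push_cast [abs_neg] at key; exact key

/-- **vKM Prop. 10.6 ⟸ Lemma 10.5 + (eq:szpiro)**, the conductor invariance supplied by the Ogg–Saito schema
(`conductorNorm_eq_of_isIsogenous_of_tate`). [cite: VonkanelMatschke2023, Prop. 10.6 (arXiv §10.4, prop:abc)] -/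
theorem abc_log_max_le_refined_of_lemma_10_5 (hmod : nonempty_modularParametrizationData)
    (hOS : ∀ (W : WeierstrassCurve ℚ) (ℓ : ℕ) [Fact ℓ.Prime], W.artinConductorExponent_tate_eq_conductorExponent_of_isElliptic ℓ)
    (h105 : vonKanelMatschke_lemma_10_5) (hsz : vonKanelMatschke_log_minimalDiscriminant_le) : abc_log_max_le_refined :=
  abc_log_max_le_refined_of_lemma_10_5_of_conductorNorm_eq hmod (conductorNorm_eq_of_isIsogenous_of_tate hOS) h105 hsz

/-- **Prop. 10.6 from the roots** (PROVED assembly): granted modularity, the Ogg–Saito schema,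
Lemma 10.5 and Prop. 10.8 (i)+(ii), the refined `abc` bound `abc_log_max_le_refined` holds — the printed
chain `Lemma 10.5 + Prop. 10.8 ⟹ (eq:szpiro) ⟹ Prop. 10.6` of §10.4–§10.5.
[cite: VonkanelMatschke2023, §10.4–§10.5 (Prop. 10.6 via (eq:szpiro) and Prop. 10.8)] -/
theorem abc_log_max_le_refined_of_modularity_of_prop_10_8 (hmod : nonempty_modularParametrizationData)
    (hOS : ∀ (W : WeierstrassCurve ℚ) (ℓ : ℕ) [Fact ℓ.Prime],
      W.artinConductorExponent_tate_eq_conductorExponent_of_isElliptic ℓ)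
    (h105 : vonKanelMatschke_lemma_10_5) (hi : vonKanelMatschke_prop_10_8_i)
    (hii : vonKanelMatschke_prop_10_8_ii) : abc_log_max_le_refined :=
  abc_log_max_le_refined_of_lemma_10_5 hmod hOS h105 (log_minimalDiscriminant_le_of_prop_10_8 hmod hi hii)

end VonKanelMatschke

end Literature.NumberTheory.DiophantineGeometry

end
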